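import Summits.ABC.IUTFork.Cor312VolumesRealDH
import Summits.ABC.IUTFork.Thm311DHShells
import Summits.ABC.IUTFork.Thm311RealLog
import HarnessLib

/-!
# [IUTchIII] Corollary 3.12, statement — the `p`-adic presentation of the M-LEVEL Dupuy–Hilado log-shell signature
# (carriers `K_{v̲}`, `v̲ ∈ V̲`, of [IUTchI] Def. 3.1 (e)); G1-Θ unit P1 of `HOME/staging/w5/w5-d166/g4/G1-THETA-SHAPES.md`

Record-only file (D-0012) of the abc-iut cell (seat abc-iut-w5-d166, gen 4; branch C «abc ⇐ S», C-lead ruling C-R12 (e)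
«target #2′: the M-level (V̲, K_{v̲}) real volume setting»). TAKES NO SIDE on [IUTchIII] Cor. 3.12.

abc-iut-c312-5's `Real.padicPresentationDH X p logv` (`Cor312VolumesRealDH`, p40xxxx) presents the Dupuy–Hilado-level
log-shell signature `Real.logShellsDH X logv` of PILOT DATA `X : PilotData F` — carriers the adic completions `F_v` at
ALL finite places `v` of `F` over `p` — as abc-iut-c312-1's `Cor312Vol.PadicPresentation` (`Cor312VolumesPadicSummands`:
fields `K_v` of the MLF class, `φ_v : log(𝒟^⊢_v) ≃ K_v`, shell `= c·log_p(𝒪^×)`, `ℚ_p`-linear shell-preserving (Ind1)/(Ind2),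
symmetric weights), from which every real-volume construction of the Cor. 3.12 crew descends (lattices
`Cor312VolumesPadicLattice*`, containers `summandPieces*`, frames `Cor312FrameVolumePieces*`, settings `settingPrVol*`).
The GENUINE Θ-volume number of abc-iut-S2 (`ThetaVolumeInput.negLogTheta`, `GenuineLogTheta`) lives instead on the
completions `K_{v̲}` of the field `K` of the initial Θ-data at the SECTION places `v̲ ∈ V̲ ≅ V_mod` ([IUTchI] Def. 3.1 (e),
kurims `paper:url-690e7b3c6199` p. 62: "`V̲ ⊆ V(K)` is a subset that induces a natural bijection `V̲ ⥲ V_mod`";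
Dupuy–Hilado Def. 3.6.1 "`K_{v̲}`") — abc-iut-c312-5's M-LEVEL index skeleton `Real.thetaIndexOfInitial D`
(`Thm311RealM`: `V := ↥D.V`, `V_ℚ := Val ℚ`) with its Dupuy–Hilado signature `Real.logShellsOfInitialDH D logvK`
(`Thm311DHShells`). The READ binder `hΘ` of branch C (abc-iut-S3's carrier scoping 07:44:48Z, adopted as C-R12) is
dischargeable only once the crew's volume stack exists over THIS skeleton. THIS FILE supplies its foundation:

* §1 the fibre of `V̲ → V_ℚ` over a nonarchimedean rational place `u` with `p ∈ 𝔭_u`: every member is a finite place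
  `w` of `K` (`finitePlaceOfM`) with `p ∈ 𝔭_w` (`natCast_mem_placeOfM`);
* §2 the M-level analyticity law `LogvAnalyticAtVal p logvK` on the `p_v`-adic-log binder (twin of c312-5's
  `LogvAnalyticAt`), DISCHARGED for c312-5's analytic family `analyticLogvVal K` (`logvAnalyticAtVal_analyticLogvVal`),
  and the shell identity `I_{v̲} = (p^*)⁻¹·log_p(𝒪^×_{K_{v̲}})` read in the rescaled completion
  (`mem_shellVal_iff_mem_smul_logUnits`, from c312-5's `mem_shell_iff_mem_smul_logUnits` at the number field `K`:
  the M-level carrier `CarrierVal (Val.non w)` IS c312-5's `Carrier (inr 𝔭_w)` of the field `K`, definitionally);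
* §3 **`padicPresentationOfInitialDH`** : `PadicPresentation (logShellsOfInitialDH D logvK) (Val.non u) p` with
  `k x := RescaledCompletion K p 𝔭_{w(x)}` — the SAME MLF-class field as abc-iut-S2's genuine local field
  `((placeSection D).localFields p).k` at the section place (`CompletionLocalFields`), so that the summands
  `X_{v⃗} = K_{v̲_0} ⊗_{ℚ_p} ⋯ ⊗_{ℚ_p} K_{v̲_j}` of every construction downstream ARE the summands of S2's
  `realPrimePacketM ((placeSection D).localFieldFamily p)` up to the index identification `v̲ ↔ v ∈ V(F_mod)_p`
  (unit P6 of the SHAPES) —, `φ = id`, `c = (p^*)⁻¹`, strip slot trivial, Ism = abc-iut-c312-5's `dhIsm`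
  (`ℚ_p`-linear by continuity, shell-preserving by definition), weights the probability weights of `V_mod`
  (`Pr(v) = n_v/[F_mod:ℚ]`, Dupuy–Hilado §3.6, abc-iut-S2 `weight`) read through `v̲ ↦ v̲ ∩ F_mod`;
* `generatorsPreserveOfInitialDH` — (Ind1)/(Ind2) invariance of the verbatim container on the M-level real log-shells
  (c312-1's generic `PadicPresentation.generatorsPreserve_toLocalPieces`), UNCONDITIONAL at `v_ℚ = u`.

[cite: Mochizuki2012, IUTchI Def. 3.1 (e) p. 62] [cite: DupuyHilado2025, Def. 3.6.1, §3.6, §4.7, §4.9]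
[claim: Mochizuki2012, status: disputed] for the quoted setting. HONEST FRAMING: bookkeeping over OUR typed objects;
nothing here bears on the truth of [IUTchIII] Cor. 3.12; typed ≠ proved; instantiated ≠ endorsed.
Deliberately NOT here: the containers/frames/settings over this presentation (units P2–P5), the comparison with
abc-iut-S2's number (P6), any judgement.
-/

noncomputable section

open Set Function NumberField IsDedekindDomain
open scoped Pointwise

namespace Summit.ABC.IUTFork.Thm311.Real

open Cor312Vol Literature.IUT.LogThetaLattice Literature.IUT.LogVolume Literature.IUT.HodgeTheaters
  Literature.NumberTheory.NumberFields

variable {F K Fbar : Type} [Field F] [NumberField F] [Field K] [NumberField K] [Algebra F K]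
  [Field Fbar] [Algebra F Fbar] [Algebra K Fbar] {E : WeierstrassCurve F} [E.IsElliptic] {l : ℕ}
  {Pb : BadPlacePredicates K} (D : InitialThetaData F K Fbar E l Pb)
  (p : ℕ) [hp : Fact p.Prime] (u : FinitePlace ℚ) (hu : ((p : ℕ) : 𝓞 ℚ) ∈ (FinitePlace.maximalIdeal u).asIdeal)

/-! ## §1. The fibre of `V̲ → V_ℚ` over a nonarchimedean rational place -/

/-- An ARCHIMEDEAN valuation of `V̲` does not lie over a nonarchimedean place of `ℚ` (restriction preserves the
archimedean/nonarchimedean dichotomy: `Val.restrict` is `Sum.map`). [folklore] -/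
theorem over_arc_ne_non (w : InfinitePlace K) (hw : Val.arc w ∈ D.V) :
    (thetaIndexOfInitial D).over ⟨Val.arc w, hw⟩ ≠ Val.non u := by
  show Val.restrict ℚ (toVMod F K E (Val.arc w)) ≠ Val.non u
  simp [toVMod, Val.restrict, Val.arc, Val.non]

/-- The finite place `w` of `K` underlying a member of the fibre of `V̲ → V_ℚ` over the nonarchimedean place `u`.
[cite: Mochizuki2012, IUTchI Def. 3.1 (e) p. 62] -/
def finitePlaceOfM : (thetaIndexOfInitial D).Fibre (Val.non u) → FinitePlace K
  | ⟨⟨.inr w, _⟩, _⟩ => w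
  | ⟨⟨.inl w, hw⟩, h⟩ => absurd h (over_arc_ne_non D u w hw)

/-- The member of the fibre IS the valuation of its finite place. [folklore] -/
theorem val_eq_non_finitePlaceOfM : ∀ x : (thetaIndexOfInitial D).Fibre (Val.non u),
    (Subtype.val (Subtype.val x) : Val K) = Val.non (finitePlaceOfM D u x)
  | ⟨⟨.inr _, _⟩, _⟩ => rfl
  | ⟨⟨.inl w, hw⟩, h⟩ => absurd h (over_arc_ne_non D u w hw)

/-- The prime `𝔭_w` of `𝓞_K` of a member of the fibre. [folklore] -/
def placeOfM (x : (thetaIndexOfInitial D).Fibre (Val.non u)) : HeightOneSpectrum (𝓞 K) :=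
  FinitePlace.maximalIdeal (finitePlaceOfM D u x)

/-- The place of `ℚ` under a finite place `w` of `K`, computed through the tower `K ⊇ F ⊇ F_mod ⊇ ℚ` as the index
skeleton does (`Real.underQ`), is the place of the prime `𝔭_w ∩ ℤ_ℚ` (three restrictions collapse: Mathlib
`Ideal.under_under`). [folklore] -/
theorem restrict_toVMod_non (w : FinitePlace K) :
    Val.restrict ℚ (toVMod F K E (Val.non w)) =
      Val.non (FinitePlace.mk ((FinitePlace.maximalIdeal w).under (𝓞 ℚ))) := by
  show Val.restrict ℚ (Val.restrict (fieldOfModuli E) (Val.restrict F (Val.non w))) = _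
  rw [restrict_non, restrict_non, restrict_non, FinitePlace.maximalIdeal_mk, FinitePlace.maximalIdeal_mk]
  congr 2
  apply HeightOneSpectrum.ext
  show (((FinitePlace.maximalIdeal w).asIdeal.under (𝓞 F)).under (𝓞 (fieldOfModuli E))).under (𝓞 ℚ) =
    (FinitePlace.maximalIdeal w).asIdeal.under (𝓞 ℚ)
  rw [Ideal.under_under, Ideal.under_under]

include hu in
omit hp in
/-- **`p ∈ 𝔭_w`** for every member `w` of the fibre over `u` (`p ∈ 𝔭_u` and `𝔭_u = 𝔭_w ∩ ℤ_ℚ`). [folklore] -/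
theorem natCast_mem_placeOfM (x : (thetaIndexOfInitial D).Fibre (Val.non u)) :
    ((p : ℕ) : 𝓞 K) ∈ (placeOfM D u x).asIdeal := by
  have hx : (thetaIndexOfInitial D).over x.1 = Val.non u := x.2
  have hx' : Val.restrict ℚ (toVMod F K E (Subtype.val (Subtype.val x) : Val K)) = Val.non u := hx
  rw [val_eq_non_finitePlaceOfM D u x, restrict_toVMod_non] at hx'
  have hwu : (FinitePlace.maximalIdeal (finitePlaceOfM D u x)).under (𝓞 ℚ) = FinitePlace.maximalIdeal u := by
    have h1 := congrArg FinitePlace.maximalIdeal (Sum.inr_injective hx')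
    rwa [FinitePlace.maximalIdeal_mk] at h1
  have hmem : ((p : ℕ) : 𝓞 ℚ) ∈ ((placeOfM D u x).under (𝓞 ℚ)).asIdeal := by
    show ((p : ℕ) : 𝓞 ℚ) ∈ ((FinitePlace.maximalIdeal (finitePlaceOfM D u x)).under (𝓞 ℚ)).asIdeal
    rw [hwu]; exact hu
  have hmem' : algebraMap (𝓞 ℚ) (𝓞 K) ((p : ℕ) : 𝓞 ℚ) ∈ (placeOfM D u x).asIdeal := Ideal.mem_comap.mp hmem
  simpa using hmem'

include hu in
/-- The residue characteristic of `𝔭_w` is `p`. [folklore] -/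
theorem residueChar_placeOfM (x : (thetaIndexOfInitial D).Fibre (Val.non u)) :
    residueChar K (placeOfM D u x) = p :=
  residueChar_eq_of_natCast_mem p (natCast_mem_placeOfM D p u hu x)

include hu in
/-- `𝔭_w ∈ V(K)_p`. [folklore] -/
theorem placeOfM_mem_placesOver (x : (thetaIndexOfInitial D).Fibre (Val.non u)) :
    placeOfM D u x ∈ placesOver K p := by
  rw [mem_placesOver_iff]
  refine ⟨le_antisymm (fun z hz => ?_) fun z hz => ?_⟩
  · obtain ⟨c, rfl⟩ := Ideal.mem_span_singleton.mp hz
    rw [Ideal.mem_comap, map_mul, map_natCast]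
    exact Ideal.mul_mem_right _ _ (natCast_mem_placeOfM D p u hu x)
  · have hprime : ((placeOfM D u x).asIdeal.under ℤ) = Ideal.span {(residueChar K (placeOfM D u x) : ℤ)} :=
      (liesOver_residueChar K (placeOfM D u x)).over.symm
    rw [hprime, residueChar_placeOfM D p u hu x] at hz
    exact hz

/-! ## §2. The analytic-logarithm law on the M-level binder and the log-shell in the rescaled completion -/

/-- **The family `logvK` is the ANALYTIC `p`-adic logarithm at the places of `K` over `p`** (M-level twin of
abc-iut-c312-5's `Real.LogvAnalyticAt`: `log_w(x) = log_p(x)` computed by campaign-S's `unitLog` in abc-iut-S7's rescaled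
completion; [IUTchIII] Def. 1.1 (i) "`log_k`", Neukirch ANT II (5.5)). A LAW on the binder `logvK` of
`Real.logShellsOfInitialDH` (not a named fact); satisfied by c312-5's `Real.analyticLogvVal`
(`logvAnalyticAtVal_analyticLogvVal`). [cite: NeukirchANT1999, Ch. II (5.5)] -/
def LogvAnalyticAtVal (logvK : PadicLogsVal K) : Prop :=
  ∀ (w : FinitePlace K) (hw : ((p : ℕ) : 𝓞 K) ∈ (FinitePlace.maximalIdeal w).asIdeal) (x : (↥(integersVal w))ˣ),
    logvK w (Additive.ofMul x) =
      ofR p (FinitePlace.maximalIdeal w) hw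
        (unitLog (toR p (FinitePlace.maximalIdeal w) hw ((x : ↥(integersVal w)) : CarrierVal (Val.non w))))

/-- c312-5's analytic family at the M level (`Real.analyticLogvVal K w = Real.analyticLogv K 𝔭_w`, definitionally) IS
analytic at every `p` (c312-5's `logvAnalyticAt_analyticLogv` for the number field `K`).
[cite: NeukirchANT1999, Ch. II (5.5)] -/
theorem logvAnalyticAtVal_analyticLogvVal : LogvAnalyticAtVal (K := K) p (analyticLogvVal K) :=
  fun w hw x => logvAnalyticAt_analyticLogv (F := K) p (FinitePlace.maximalIdeal w) hw x

/-- **The M-level log-shell is `(p^*)⁻¹·log_p(𝒪^×)`**: at a finite place `w` of `K` over `p` where `logvK` is analytic,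
membership in `Real.shellVal logvK (Val.non w) = (p_w^*)⁻¹·log_w(𝒪_w^×)` ([IUTchIII] Rmk. 1.2.2 (i); abc-iut-L6-t3
`nonarchLogShell`), read in the rescaled completion (same underlying set), is membership in
`(p^*)⁻¹ • log_p(𝒪^×)` (campaign-S `logUnits`) — c312-5's `mem_shell_iff_mem_smul_logUnits` for the number field `K`
(the M-level carrier and shell at `Val.non w` ARE c312-5's `Carrier`/`shell` of `K` at `𝔭_w`, definitionally, for the
`PadicLogs K`-family `𝔭 ↦ logvK (FinitePlace.mk 𝔭)` read at `𝔭_w`; proved here directly to avoid that transport).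
[claim: Mochizuki2012, status: disputed] -/
theorem mem_shellVal_iff_mem_smul_logUnits {logvK : PadicLogsVal K} (hlog : LogvAnalyticAtVal p logvK)
    (w : FinitePlace K) (hw : ((p : ℕ) : 𝓞 K) ∈ (FinitePlace.maximalIdeal w).asIdeal)
    (a : RescaledCompletion K p (FinitePlace.maximalIdeal w) hw) :
    ofR p (FinitePlace.maximalIdeal w) hw a ∈ shellVal logvK (Val.non w) ↔
      a ∈ ((pStar p : ℕ) : ℚ_[p])⁻¹ • logUnits (RescaledCompletion K p (FinitePlace.maximalIdeal w) hw) := by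
  have hres : residueChar K (FinitePlace.maximalIdeal w) = p := residueChar_eq_of_natCast_mem p hw
  have hc : algebraMap ℚ_[p] (RescaledCompletion K p (FinitePlace.maximalIdeal w) hw) ((pStar p : ℕ) : ℚ_[p])⁻¹ =
      ((pStar p : ℕ) : RescaledCompletion K p (FinitePlace.maximalIdeal w) hw)⁻¹ := by
    rw [map_inv₀, map_natCast]
  show ofR p (FinitePlace.maximalIdeal w) hw a ∈
      nonarchLogShell (integersVal w) (logvK w) (residueChar K (FinitePlace.maximalIdeal w)) ↔ _
  rw [hres, Set.mem_smul_set]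
  constructor
  · rintro ⟨x, hx⟩
    refine ⟨unitLog (toR p (FinitePlace.maximalIdeal w) hw ((x : ↥(integersVal w)) : CarrierVal (Val.non w))),
      ⟨_, norm_of_unit (FinitePlace.maximalIdeal w) hw x, rfl⟩, ?_⟩
    rw [Algebra.smul_def, hc]
    rw [hlog w hw x] at hx
    exact (congrArg (toR p (FinitePlace.maximalIdeal w) hw) hx).symm
  · rintro ⟨z, ⟨y, hy, rfl⟩, rfl⟩
    obtain ⟨x, rfl⟩ := exists_unit_of_norm_eq_one (FinitePlace.maximalIdeal w) hw hy
    refine ⟨x, ?_⟩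
    rw [hlog w hw x, Algebra.smul_def, hc]
    rfl

/-! ## §3. The `p`-adic presentation of the M-level Dupuy–Hilado signature -/

section Presentation

variable (logvK : PadicLogsVal K)

/-- **`K_{v̲}` as a field of the MLF class**: abc-iut-S7's `RescaledCompletion K p 𝔭_w` at the finite place `w` of `K`
underlying the member of the fibre — the SAME type, field and topology as the M-level carrier `Real.CarrierVal (Val.non w)`
and as abc-iut-S2's genuine local field `((placeSection D).localFields p).k` at a section place (`CompletionLocalFields`,
up to the place index). [cite: NeukirchANT1999, Ch. II Thm. (4.8)] -/
abbrev kOfM (x : (thetaIndexOfInitial D).Fibre (Val.non u)) : Type :=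
  RescaledCompletion K p (placeOfM D u x) (natCast_mem_placeOfM D p u hu x)

/-- The `ℚ`-module structure of `K_{v̲}`: THAT of the M-level carrier `Real.CarrierVal`. [folklore] -/
@[reducible] def kOfMRatModule : ∀ x : (thetaIndexOfInitial D).Fibre (Val.non u), Module ℚ (kOfM D p u hu x)
  | ⟨⟨.inr w, _⟩, _⟩ => (inferInstance : Module ℚ (CarrierVal (K := K) (Val.non w)))
  | ⟨⟨.inl w, hw⟩, h⟩ => absurd h (over_arc_ne_non D u w hw)

/-- **`φ_{v̲} = id`**: the carrier `log(𝒟^⊢_{v̲}) = K_{v̲}` of the M-level signature IS the rescaled completion, as a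
`ℚ`-module. [folklore] -/
def φOfM : ∀ x : (thetaIndexOfInitial D).Fibre (Val.non u),
      letI := kOfMRatModule D p u hu x; (logShellsOfInitialDH D logvK).carrier x.1 ≃ₗ[ℚ] kOfM D p u hu x
  | ⟨⟨.inr w, _⟩, _⟩ => LinearEquiv.refl ℚ (CarrierVal (K := K) (Val.non w))
  | ⟨⟨.inl w, hw⟩, h⟩ => absurd h (over_arc_ne_non D u w hw)

/-- The finite place of `F_mod` under a member of the fibre (`v̲ ↦ v ∈ V_mod`, through `F`). [folklore] -/
def placeModOfM (x : (thetaIndexOfInitial D).Fibre (Val.non u)) : HeightOneSpectrum (𝓞 (fieldOfModuli E)) :=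
  ((placeOfM D u x).under (𝓞 F)).under (𝓞 (fieldOfModuli E))

/-- **The NORMALIZED WEIGHT of the summand `v⃗`**: the product of the probability weights `Pr(v_a) = n_{v_a}/[F_mod:ℚ]`
of the places of `V_mod` under the `v̲_a` (Dupuy–Hilado §3.6 "`Pr(v) = [F_{0,v}:ℚ_p]/[F₀:ℚ]`" with `F₀ = F_mod`;
[IUTchIII] Rmk. 3.1.1 (ii); abc-iut-S2's `weight`). [cite: DupuyHilado2025, §3.6] -/
def weightM (j : (thetaIndexOfInitial D).Label)
    (e : (thetaIndexOfInitial D).Caps j → (thetaIndexOfInitial D).Fibre (Val.non u)) : ℝ :=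
  ∏ a, weight (fieldOfModuli E) (placeModOfM D u (e a))

/-- The weight is nonnegative. [folklore] -/
theorem weightM_nonneg (j : (thetaIndexOfInitial D).Label)
    (e : (thetaIndexOfInitial D).Caps j → (thetaIndexOfInitial D).Fibre (Val.non u)) : 0 ≤ weightM D u j e :=
  Finset.prod_nonneg fun _ _ => weight_nonneg (fieldOfModuli E) _

/-- The weight is symmetric under permutations of the capsule index. [folklore] -/
theorem weightM_perm (j : (thetaIndexOfInitial D).Label) (σ : Equiv.Perm ((thetaIndexOfInitial D).Caps j))
    (e : (thetaIndexOfInitial D).Caps j → (thetaIndexOfInitial D).Fibre (Val.non u)) :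
    weightM D u j (e ∘ σ) = weightM D u j e :=
  Fintype.prod_equiv σ (fun a => weight (fieldOfModuli E) (placeModOfM D u (e (σ a))))
    (fun a => weight (fieldOfModuli E) (placeModOfM D u (e a))) fun _ => rfl

/-- The rational place `u` is nonarchimedean for the index skeleton. [folklore] -/
theorem isNon_over (x : (thetaIndexOfInitial D).Fibre (Val.non u)) :
    (thetaIndexOfInitial D).IsNon ((thetaIndexOfInitial D).over x.1) := by
  rw [x.2]; trivial

/-- **The `p`-adic presentation of the M-LEVEL Dupuy–Hilado signature** `Real.logShellsOfInitialDH D logvK` over the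
nonarchimedean rational place `u ∋ p`, for `logvK` analytic over `p`: `K_{v̲}` = the rescaled completion of `K` at the
section place, `φ_{v̲} = id`, `c = (p^*)⁻¹`, `Ism`-elements `ℚ_p`-linear (continuity) and shell-preserving (definition of
abc-iut-c312-5's `dhIsm`), strip-automorphisms trivial, weights the probability weights of `V_mod` — the twin of
abc-iut-c312-5's `Real.padicPresentationDH` with the GENUINE carriers of [IUTchI] Def. 3.1 (e) / Dupuy–Hilado Def. 3.6.1.
[claim: Mochizuki2012, status: disputed] -/
def padicPresentationOfInitialDH (hlog : LogvAnalyticAtVal p logvK) :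
    PadicPresentation (logShellsOfInitialDH D logvK) (Val.non u) p where
  k := kOfM D p u hu
  instField x := inferInstanceAs (NontriviallyNormedField (RescaledCompletion K p _ _))
  instAlg x := inferInstanceAs (NormedAlgebra ℚ_[p] (RescaledCompletion K p _ _))
  instUltra x := inferInstanceAs (IsUltrametricDist (RescaledCompletion K p _ _))
  instProper x := inferInstanceAs (ProperSpace (RescaledCompletion K p _ _))
  instRat := kOfMRatModule D p u hu
  φ := φOfM D p u hu logvK
  c := ((pStar p : ℕ) : ℚ_[p])⁻¹
  c_ne_zero := inv_ne_zero (Nat.cast_ne_zero.mpr (pStar_ne_zero hp.out.ne_zero))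
  shell_eq := by
    rintro ⟨⟨x1, hm⟩, h⟩
    rcases x1 with w | w
    · exact absurd h (over_arc_ne_non D u w hm)
    · ext a
      have key := mem_shellVal_iff_mem_smul_logUnits p hlog w (natCast_mem_placeOfM D p u hu ⟨⟨Val.non w, hm⟩, h⟩) a
      refine ⟨?_, fun ha => ⟨ofR p (FinitePlace.maximalIdeal w) _ a, key.2 ha, rfl⟩⟩
      rintro ⟨b, hb, hba⟩
      have hba' : b = ofR p (FinitePlace.maximalIdeal w) (natCast_mem_placeOfM D p u hu ⟨⟨Val.non w, hm⟩, h⟩) a := hba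
      subst hba'
      exact key.1 hb
  strip_linear := by
    rintro ⟨⟨x1, hm⟩, h⟩ g hg
    rcases x1 with w | w
    · exact absurd h (over_arc_ne_non D u w hm)
    · have hg' : g = LinearEquiv.refl ℚ _ := hg
      subst hg'
      exact ⟨LinearEquiv.refl ℚ_[p] _, fun _ => rfl⟩
  strip_shell := by
    rintro x g hg
    have hg' : g = LinearEquiv.refl ℚ _ := hg
    subst hg'
    simp
  ism_linear := by
    rintro ⟨⟨x1, hm⟩, h⟩ g hg
    rcases x1 with w | w
    · exact absurd h (over_arc_ne_non D u w hm)
    · have hg' : g ∈ ((logShellsOfInitial₁ D logvK).toDH (topologyOfInitial D logvK)).ism ⟨Val.non w, hm⟩ := hg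
      rw [LogShells.toDH_ism_of_isNon _ _ (isNon_over D u ⟨⟨Val.non w, hm⟩, h⟩)] at hg'
      exact ⟨padicLinearOf p (FinitePlace.maximalIdeal w)
        (natCast_mem_placeOfM D p u hu ⟨⟨Val.non w, hm⟩, h⟩) g hg'.1, fun _ => rfl⟩
  ism_shell := by
    rintro ⟨⟨x1, hm⟩, h⟩ g hg
    rcases x1 with w | w
    · exact absurd h (over_arc_ne_non D u w hm)
    · have hg' : g ∈ ((logShellsOfInitial₁ D logvK).toDH (topologyOfInitial D logvK)).ism ⟨Val.non w, hm⟩ := hg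
      rw [LogShells.toDH_ism_of_isNon _ _ (isNon_over D u ⟨⟨Val.non w, hm⟩, h⟩)] at hg'
      exact hg'.2.2
  w := weightM D u
  w_nonneg := weightM_nonneg D u
  w_perm j σ e := weightM_perm D u j σ e

/-- **(Ind1)/(Ind2) INVARIANCE OF THE VERBATIM CONTAINER ON THE M-LEVEL REAL LOG-SHELLS, UNCONDITIONAL at `v_ℚ = u`**
(abc-iut-c312-1's generic `PadicPresentation.generatorsPreserve_toLocalPieces`; [IUTchIII] proof of Cor. 3.12, Step (x),
p. 181 "invariant with respect to the indeterminacies (Ind1), (Ind2)"). [cite: DupuyHilado2025, §4.7, §4.9] -/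
theorem generatorsPreserveOfInitialDH (hlog : LogvAnalyticAtVal p logvK) :
    (padicPresentationOfInitialDH D p u hu logvK hlog).toLocalPieces.GeneratorsPreserve :=
  (padicPresentationOfInitialDH D p u hu logvK hlog).generatorsPreserve_toLocalPieces

/-- The same for c312-5's ANALYTIC family `Real.analyticLogvVal K` — no hypothesis left on the logarithms.
[cite: DupuyHilado2025, §4.7, §4.9] -/
theorem generatorsPreserveOfInitialDH_analytic :
    (padicPresentationOfInitialDH D p u hu (analyticLogvVal K)
      (logvAnalyticAtVal_analyticLogvVal p)).toLocalPieces.GeneratorsPreserve :=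
  generatorsPreserveOfInitialDH D p u hu _ _

/-- The field of the presentation at a member of the fibre IS the rescaled completion at its place (definitional;
recorded for the index identification with abc-iut-S2's `PlaceSection.localFields_k`). [folklore] -/
theorem padicPresentationOfInitialDH_k (hlog : LogvAnalyticAtVal p logvK) (x : (thetaIndexOfInitial D).Fibre (Val.non u)) :
    (padicPresentationOfInitialDH D p u hu logvK hlog).k x =
      RescaledCompletion K p (placeOfM D u x) (natCast_mem_placeOfM D p u hu x) := rfl

end Presentation

end Summit.ABC.IUTFork.Thm311.Real

end
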